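/-
Copyright (c) 2026 the pub-hodgecm-mathlib formalisation cell (harness21).  Prover seat hodgecm-mathlib-K2E3-p23 (g6), HCML Track B «K2-LIT» ∕ h413
(`stmt-HodgeConjecture-24833`), line `K2_E3_EllipticInputs`, road «GL₂-sc» (road owner K2E5-p17 (g5), dealer K2E3-plan (g4)), NON-ELLIPTIC half, brick 2N-3 (T20₂):
the `Fin 2` reading of ★ T20-GL₃ `K2E3GL3CuspFormCancellation` (K2E5-p17 (g4)) — HARISH-CHANDRA'S CUSP-FORM CANCELLATION FOR `GL₂(F)`, UPSTAIRS: for `y ∈ 𝔅_s` and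
`x ∉ 𝔅_{m_C + (m + 2s + 4m_C) + s}`, `∫_{GL₂(𝒪)} f(x k y) dk = 0` (`Γ = A` the split torus, ONE base direction: the Borel).  2026-09-04.
-/
import Summits.HodgeConjecture.HodgeConjecture.Theorems.K2E3GL3CuspFormCancellation     -- ★ T20-GL₃ (K2E5-p17 g4): the GENERIC §1 dictionary (`coe_permGL_inv_mul_mul_permGL`, `coe_eq_diagonal_of_mem_standardLeviGL_id`, `permGL_inv_mul_mul_permGL_mem_standardLeviGL_id`, `adBall_conj_iff_of_mem_glInt`, `adBall_zero_of_mem_glInt`); brings ★ (A′) engine, ★ (B-val) Inputs, ★ (B-Iw) FILES 1–2, ★ `GLn.isMulRightInvariant_of_isHaarMeasure_local`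
import Summits.HodgeConjecture.HodgeConjecture.Theorems.K2E3GL2ModCentre                   -- ★ (2F-a) p858726 (K2E5-p17 g5): `secondCountableTopology_gl2`, `locallyCompactSpace_gl2`
import HarnessLib

/-!
# Road «GL₂-sc», non-elliptic half, brick 2N-3 (T20₂) — THEOREM 20 (Harish-Chandra's cusp-form cancellation) for `GL₂(F)`, upstairs, split torus

Cell `pub/hodgecm-mathlib` (D-0151), Track B «K2-LIT», crux H413 = `stmt-HodgeConjecture-24833`, route of record `HCCMUnconditional`.  Lane
`--supports stmt-HodgeConjecture-24833 --as helper`; THEOREMS ONLY (no `def`, no `instance`, no `notation`, no named-fact hypothesis, no `sorry`); count-neutral.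
`Fin 2` reading of ★ T20-GL₃ (K2E5-p17 (g4), road «GL-[M6]-sc» BLUEPRINT v4 §2).  [HarishChandra1970, Part VII §2 Theorem 20 p. 70; §3 p. 71; §8 pp. 80–84]:
`G = GL₂(F)` upstairs, scale-invariant height balls `Ω k = 𝔅_k` (★ `K2E3GLnAdHeightBalls`), level `K₀ = K_m = congruenceGL 2 (valuation F ϖ ^ m)` (`m ≥ 1`), deep levels
`L j = K_j`, full level `K₁ = GL₂(𝒪) = glInt 2 F`, a continuous `f` with `supp f ⊆ 𝔅_{m_C} · A`, `A = M_{id}` the diagonal torus.  The generic engine ★ (A′)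
`cuspForm_cancellation_polychotomy_levelOne_of_base` is fed with `W = S₂` (permutation matrices `w_σ = permGL σ ∈ GL₂(𝒪)`), ONE base direction (`ι = Fin 1`): the
BOREL triple `(V, T, U) = (N̄, A, N)` (labels `id : Fin 2 → Fin 2`), depth `E + 1`, defect `0`, cover radius `E` with `E := m + 2s + 4m_C` — at `N = 2` the split torus
modulo the centre has rank one, `A ∖ 𝔅_E = A⁺ ∪ A⁻` (no maximal-parabolic regimes, no `6E`).  All structural inputs are the ★ generic-`n` lemmas of ★ (B-val)
`K2E3GLnCuspFormCancellationInputs` and ★ (B-Iw) `K2E3GLnCongruenceIwahoriOrders` at `n = 2`, labels `id`.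
* §1 `cover_of_not_adBall_two` — the cover of the split torus of `GL₂`: `t = diag(d) ∉ 𝔅_R`, `E ≤ R` ⇒ some chamber `σ ∈ S₂` has `|d_{σ0}⁻¹ d_{σ1}| ≤ |ϖ^{E+1}|`.
* §2 **`cuspForm_cancellation_GL2_split (hϖ) (μ) (hm : 1 ≤ m) (hy : 𝔅_s(y)) (f) (hf) (hsupp : supp f ⊆ 𝔅_{m_C}·A) (hcuspB : ∀ σ ν₀ x, ∫_{N} f(x · w_σ u w_σ⁻¹) dν₀ = 0)
  (hx : x ∉ 𝔅_{m_C + (m + 2s + 4m_C) + s}) : ∫_{k ∈ GL₂(𝒪)} f(x k y) dμ = 0`**.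
The cusp-form hypothesis is the HONEST transported one (discharged for supercuspidal slices by 2N-4 via ★ `K2E3GL2SupercuspidalTwistDescent`-side cusp conditions).
HONEST LABEL: HC_CM is proved only modulo the 7 printed citations (2 remaining named inputs: hLiu418 = stmt-HodgeConjecture-24832, h413 = stmt-HodgeConjecture-24833)
until rung 0 closes; count-neutral helper.

## References
* [HarishChandra1970] Harish-Chandra (notes by G. van Dijk), *Harmonic Analysis on Reductive p-adic Groups*, LNM 162 (1970), Part VII §2 Thm. 20 p. 70, §3 p. 71, §8 pp. 80–84.
* [Casselman1995] W. Casselman, *Introduction to the theory of admissible representations of p-adic reductive groups* (1995), Prop. 1.4.3–1.4.4.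
* [BernsteinZelevinsky1977] I. N. Bernstein, A. V. Zelevinsky, Ann. Sci. ÉNS 10 (1977), §2.1.
-/

set_option autoImplicit false
set_option linter.dupNamespace false   -- `Summit.HodgeConjecture.HodgeConjecture.…` (D-0017 nested layout; lakefile exemption for Summits)

noncomputable section

open scoped MatrixGroups WithZero Pointwise
open MeasureTheory MeasureTheory.Measure Matrix ValuativeRel Topology
open Literature.NumberTheory.Automorphic
open Summit.HodgeConjecture.HodgeConjecture.Cruxes.H413.K2E3GLnAdHeightBalls
open Summit.HodgeConjecture.HodgeConjecture.Cruxes.H413.K2E3GLnUnipotentAdHeight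
open Summit.HodgeConjecture.HodgeConjecture.Cruxes.H413.K2E3GLnCuspFormCancellationInputs
open Summit.HodgeConjecture.HodgeConjecture.Cruxes.H413.K2E3GLnCongruenceIwahoriTriple
open Summit.HodgeConjecture.HodgeConjecture.Cruxes.H413.K2E3CuspFormCancellationPolychotomyTransport
open Summit.HodgeConjecture.HodgeConjecture.Cruxes.H413.K2E3GL3CuspFormCancellation
  (coe_permGL_inv_mul_mul_permGL coe_eq_diagonal_of_mem_standardLeviGL_id permGL_inv_mul_mul_permGL_mem_standardLeviGL_id adBall_conj_iff_of_mem_glInt adBall_zero_of_mem_glInt)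

namespace Summit.HodgeConjecture.HodgeConjecture.Cruxes.H413.K2E3GL2CuspFormCancellation

/-! ## §1 The cover of the split torus of `GL₂`: two chambers, one regime -/

section Cover

variable {F : Type*} [Field F] [Valued F ℤᵐ⁰] {ϖ : F} (hϖ : Valued.v ϖ = WithZero.exp (-1 : ℤ))

include hϖ in
/-- **THE COVER OF THE SPLIT TORUS OF `GL₂`** (the `hcover` input of ★ (A′) for `Γ = A`): for `t = diag(d)` outside `𝔅_R` with `E ≤ R` there is a chamber `σ ∈ S₂`
with `d ∘ σ` in the BOREL regime (`c = id`, depth `E+1`, defect `0`): `|d_{σ0}⁻¹ d_{σ1}| ≤ |ϖ^{E+1}|` (and the vacuous diagonal condition).  Rank one: `A ∖ 𝔅_R = A⁺ ∪ A⁻`.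
[cite: HarishChandra1970, Part VII §8 p. 80 (`A = ⋃_s A^+(t)^s`)] [cite: Casselman1995, Prop. 1.4.3] -/
theorem cover_of_not_adBall_two {t : GL (Fin 2) F} {d : Fin 2 → F} (ht : (t : Matrix (Fin 2) (Fin 2) F) = Matrix.diagonal d) {E R : ℕ} (hR : E ≤ R)
    (hfar : ¬ ∀ i j k l, Valued.v (ϖ ^ R * ((t : Matrix (Fin 2) (Fin 2) F) i j * ((t⁻¹ : GL (Fin 2) F) : Matrix (Fin 2) (Fin 2) F) k l)) ≤ 1) :
    ∃ σ : Equiv.Perm (Fin 2),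
      (∀ i j : Fin 2, (id : Fin 2 → Fin 2) i < (id : Fin 2 → Fin 2) j → Valued.v ((d (σ i))⁻¹ * d (σ j)) ≤ Valued.v (ϖ ^ (E + 1))) ∧
        ∀ i j : Fin 2, (id : Fin 2 → Fin 2) i = (id : Fin 2 → Fin 2) j → Valued.v (ϖ ^ 0 * (d (σ i) * (d (σ j))⁻¹)) ≤ 1 := by
  obtain ⟨x, hx⟩ := exists_v_eq_exp d (ne_zero_of_coe_eq_diagonal ht)
  -- outside `𝔅_R`: some `|ϖ^R d_i/d_j| > 1`, i.e. `x_i − x_j > R ≥ E`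
  rw [adBall_iff_of_coe_eq_diagonal ϖ R ht] at hfar
  push Not at hfar
  obtain ⟨i, j, hij⟩ := hfar
  have hgap : (R : ℤ) < x i - x j := by
    have h := (not_congr (v_pow_mul_div_le_one_iff hϖ hx i j R)).1 (not_le.2 hij)
    omega
  have hne : i ≠ j := by rintro rfl; omega
  -- the chamber `σ = (0 ↦ i, 1 ↦ j)`
  set σ : Equiv.Perm (Fin 2) := if i = 0 then 1 else Equiv.swap 0 1 with hσ
  have h2 : ∀ a : Fin 2, a = 0 ∨ a = 1 := by decide
  have hσ0 : σ 0 = i ∧ σ 1 = j := by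
    rcases h2 i with rfl | rfl <;> rcases h2 j with rfl | rfl
    · exact absurd rfl hne
    · simp [hσ]
    · simp [hσ, Equiv.swap_apply_left, Equiv.swap_apply_right]
    · exact absurd rfl hne
  have hxσ : ∀ a, Valued.v ((d ∘ σ) a) = WithZero.exp ((x ∘ σ) a) := fun a => hx (σ a)
  refine ⟨σ, fun a b hab => (v_inv_mul_le_iff hϖ hxσ a b (E + 1)).2 ?_, fun a b hab => (v_pow_mul_div_le_one_iff hϖ hxσ a b 0).2 ?_⟩
  · have hab' : a = 0 ∧ b = 1 := by
      rcases h2 a with rfl | rfl <;> rcases h2 b with rfl | rfl <;> simp at hab ⊢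
    obtain ⟨rfl, rfl⟩ := hab'
    simp only [Function.comp_apply, hσ0.1, hσ0.2]
    push_cast
    omega
  · simp only [id_eq] at hab
    subst hab
    simp

end Cover

/-! ## §2 Theorem 20 for `GL₂(F)`, split torus, on the full level `K₁ = GL₂(𝒪)` -/

section Split

variable {F : Type*} [Field F] [Valued F ℤᵐ⁰] [ValuativeRel F] [(Valued.v : Valuation F ℤᵐ⁰).Compatible] [IsNonarchimedeanLocalField F]
  [MeasurableSpace (GL (Fin 2) F)] [BorelSpace (GL (Fin 2) F)]
  {E' : Type*} [NormedAddCommGroup E'] [NormedSpace ℝ E']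

/-- **THEOREM 20 FOR `GL₂(F)` ON THE FULL LEVEL `K₁ = GL₂(𝒪)`, SPLIT TORUS.**  Let `m ≥ 1`, `y ∈ 𝔅_s`, `μ` a Haar measure on `GL₂(F)` (automatically right invariant),
`f` continuous with `supp f ⊆ 𝔅_{m_C} · A` (`A = M_{id}` the diagonal torus), and suppose the HONEST cusp conditions: for every chamber `σ ∈ S₂`, every Haar measure `ν₀`
of the upper unitriangular `N = U_{id}` and every `x`, `∫_N f(x · permGL σ · u · (permGL σ)⁻¹) dν₀(u) = 0`.  Then for every `x ∉ 𝔅_{m_C + (m + 2s + 4m_C) + s}`: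
**`∫_{k ∈ GL₂(𝒪)} f(x k y) dμ(k) = 0`.**  ★ (A′) `cuspForm_cancellation_polychotomy_levelOne_of_base` with `W = S₂`, `ι = Fin 1` (Borel only), all structural inputs ★
(B-val)∕(B-Iw)∕B4-0 at `n = 2`. [cite: HarishChandra1970, Part VII §2 Theorem 20 p. 70; §3 p. 71; §8 pp. 80–84] [cite: Casselman1995, Prop. 1.4.3–1.4.4] -/
theorem cuspForm_cancellation_GL2_split {ϖ : F} (hϖ : Valued.v ϖ = WithZero.exp (-1 : ℤ)) (μ : Measure (GL (Fin 2) F)) [μ.IsHaarMeasure]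
    {m : ℕ} (hm : 1 ≤ m) {s : ℕ} {y : GL (Fin 2) F}
    (hy : ∀ i j k l, Valued.v (ϖ ^ s * ((y : Matrix (Fin 2) (Fin 2) F) i j * ((y⁻¹ : GL (Fin 2) F) : Matrix (Fin 2) (Fin 2) F) k l)) ≤ 1)
    (f : GL (Fin 2) F → E') (hf : Continuous f) {mC : ℕ}
    (hsupp : ∀ g, f g ≠ 0 → g ∈ {x : GL (Fin 2) F | ∀ i j k l, Valued.v (ϖ ^ mC * ((x : Matrix (Fin 2) (Fin 2) F) i j *
      ((x⁻¹ : GL (Fin 2) F) : Matrix (Fin 2) (Fin 2) F) k l)) ≤ 1} * ((standardLeviGL F (id : Fin 2 → Fin 2) : Subgroup (GL (Fin 2) F)) : Set (GL (Fin 2) F)))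
    (hcuspB : ∀ (σ : Equiv.Perm (Fin 2)) (ν₀ : Measure ↥(unipotentRadicalGL F (id : Fin 2 → Fin 2))), ν₀.IsHaarMeasure →
      ∀ x : GL (Fin 2) F, ∫ u, f (x * (permGL σ * (u : GL (Fin 2) F) * (permGL σ)⁻¹)) ∂ν₀ = 0)
    {x : GL (Fin 2) F}
    (hx : ¬ ∀ i j k l, Valued.v (ϖ ^ (mC + (m + 2 * s + 4 * mC) + s) * ((x : Matrix (Fin 2) (Fin 2) F) i j *
      ((x⁻¹ : GL (Fin 2) F) : Matrix (Fin 2) (Fin 2) F) k l)) ≤ 1) :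
    ∫ k in ((glInt 2 F : Subgroup (GL (Fin 2) F)) : Set (GL (Fin 2) F)), f (x * k * y) ∂μ = 0 := by
  classical
  haveI : T2Space F := (Literature.NumberTheory.GaloisRepresentations.IsNonarchimedeanLocalField.isLocalField F).toT2Space
  haveI : SecondCountableTopology (GL (Fin 2) F) := K2E3GL2ModCentre.secondCountableTopology_gl2 F
  haveI : LocallyCompactSpace (GL (Fin 2) F) := K2E3GL2ModCentre.locallyCompactSpace_gl2 F
  haveI : μ.IsMulRightInvariant := GLn.isMulRightInvariant_of_isHaarMeasure_local 2 F μ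
  -- the uniformiser in both currencies
  have hϖ0 : ϖ ≠ 0 := ne_zero_of_v_eq_exp hϖ
  have hvϖ0 : valuation F ϖ ≠ 0 := (Valuation.ne_zero_iff _).2 hϖ0
  have hvϖ1 : valuation F ϖ < 1 := by
    rw [← v_lt_one_iff_valuation_lt_one, hϖ, ← WithZero.exp_zero, WithZero.exp_lt_exp]; norm_num
  have hγ1 : valuation F ϖ ^ m < 1 := pow_lt_one₀ zero_le hvϖ1 (by omega)
  have hγ0 : valuation F ϖ ^ m ≠ 0 := pow_ne_zero _ hvϖ0
  -- the objects
  set Ω : ℕ → Set (GL (Fin 2) F) := fun k => {g | ∀ i j a b, Valued.v (ϖ ^ k * ((g : Matrix (Fin 2) (Fin 2) F) i j *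
    ((g⁻¹ : GL (Fin 2) F) : Matrix (Fin 2) (Fin 2) F) a b)) ≤ 1} with hΩ
  have hΩmem : ∀ k g, g ∈ Ω k ↔ ∀ i j a b, Valued.v (ϖ ^ k * ((g : Matrix (Fin 2) (Fin 2) F) i j * ((g⁻¹ : GL (Fin 2) F) : Matrix (Fin 2) (Fin 2) F) a b)) ≤ 1 :=
    fun k g => Iff.rfl
  have hΩmul : ∀ {a b : ℕ} {g g' : GL (Fin 2) F}, g ∈ Ω a → g' ∈ Ω b → g * g' ∈ Ω (a + b) := fun hg hg' => adBall_mul hg hg'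
  have hΩinv : ∀ {a : ℕ} {g : GL (Fin 2) F}, g ∈ Ω a → g⁻¹ ∈ Ω a := fun {a} {g} hg =>
    (hΩmem a g⁻¹).2 (by simpa only [inv_inv] using adBall_inv hg)
  set K₀ : Subgroup (GL (Fin 2) F) := congruenceGL 2 (valuation F ϖ ^ m) with hK₀
  set L : ℕ → Subgroup (GL (Fin 2) F) := fun j => congruenceGL 2 (valuation F ϖ ^ j) with hL
  set A : Subgroup (GL (Fin 2) F) := standardLeviGL F (id : Fin 2 → Fin 2) with hA
  set E : ℕ := m + 2 * s + 4 * mC with hE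
  -- the one base direction (Borel)
  set U : Fin 1 → Subgroup (GL (Fin 2) F) := fun _ => unipotentRadicalGL F (id : Fin 2 → Fin 2) with hU
  set V : Fin 1 → Subgroup (GL (Fin 2) F) := fun _ => unipotentRadicalGL F (⇑OrderDual.toDual ∘ (id : Fin 2 → Fin 2)) with hV
  set T : Fin 1 → Subgroup (GL (Fin 2) F) := fun _ => standardLeviGL F (id : Fin 2 → Fin 2) with hT
  set D : Fin 1 → ℕ := fun _ => 0 with hD
  set P : Fin 1 → Set (GL (Fin 2) F) := fun _ =>
    {a | ∃ d : Fin 2 → F, (a : Matrix (Fin 2) (Fin 2) F) = Matrix.diagonal d ∧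
      (∀ i j : Fin 2, (id : Fin 2 → Fin 2) i < (id : Fin 2 → Fin 2) j → Valued.v ((d i)⁻¹ * d j) ≤ Valued.v (ϖ ^ (E + 1))) ∧
        ∀ i j : Fin 2, (id : Fin 2 → Fin 2) i = (id : Fin 2 → Fin 2) j → Valued.v (ϖ ^ 0 * (d i * (d j)⁻¹)) ≤ 1} with hP
  set w : Equiv.Perm (Fin 2) → GL (Fin 2) F := fun σ => permGL σ with hw
  -- the conjugators normalise `K_j`, `𝔅_k`, `A`
  have hwI : ∀ σ, w σ ∈ glInt 2 F := fun σ => permGL_mem_glInt σ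
  have hwK : ∀ σ (j : ℕ), ∀ k ∈ congruenceGL 2 (valuation F ϖ ^ j), w σ * k * (w σ)⁻¹ ∈ congruenceGL 2 (valuation F ϖ ^ j) :=
    fun σ j k hk => conj_mem_congruenceGL_of_mem_glInt (hwI σ) hk
  have hwK' : ∀ σ (j : ℕ), ∀ k ∈ congruenceGL 2 (valuation F ϖ ^ j), (w σ)⁻¹ * k * w σ ∈ congruenceGL 2 (valuation F ϖ ^ j) := by
    intro σ j k hk
    have h := conj_mem_congruenceGL_of_mem_glInt (Subgroup.inv_mem _ (hwI σ)) hk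
    rwa [inv_inv] at h
  have hwΩ : ∀ σ (k : ℕ) (g : GL (Fin 2) F), g ∈ Ω k → w σ * g * (w σ)⁻¹ ∈ Ω k := fun σ k g hg =>
    (adBall_conj_iff_of_mem_glInt ϖ k (hwI σ) g).2 hg
  have hwΩ' : ∀ σ (k : ℕ) (g : GL (Fin 2) F), g ∈ Ω k → (w σ)⁻¹ * g * w σ ∈ Ω k := by
    intro σ k g hg
    have h := (adBall_conj_iff_of_mem_glInt ϖ k (Subgroup.inv_mem _ (hwI σ)) g).2 hg
    exact (hΩmem k _).2 (by simpa only [inv_inv] using h)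
  have hwA' : ∀ σ, ∀ a ∈ A, (w σ)⁻¹ * a * w σ ∈ A := fun σ a ha => permGL_inv_mul_mul_permGL_mem_standardLeviGL_id σ ha
  -- levels
  have hK₁Ω : ((glInt 2 F : Subgroup (GL (Fin 2) F)) : Set (GL (Fin 2) F)) ⊆ Ω 0 := fun k hk => adBall_zero_of_mem_glInt ϖ hk
  have hK₀K₁ : K₀ ≤ glInt 2 F := congruenceGL_le_glInt _
  have hK₁o : IsOpen ((glInt 2 F : Subgroup (GL (Fin 2) F)) : Set (GL (Fin 2) F)) := isOpen_glInt 2 F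
  have hK₁c : IsCompact ((glInt 2 F : Subgroup (GL (Fin 2) F)) : Set (GL (Fin 2) F)) := isCompact_glInt 2 F
  have hK₀o : IsOpen (K₀ : Set (GL (Fin 2) F)) := isOpen_congruenceGL hγ0
  have hK₀c : IsCompact (K₀ : Set (GL (Fin 2) F)) := isCompact_congruenceGL _
  have hdeep : ∀ u ∈ L (m + 2 * s), u ∈ K₀ ∧ y * u * y⁻¹ ∈ K₀ := by
    intro u hu
    have hu' : u ∈ congruenceGL 2 (valuation F ϖ ^ (m + s)) := congruenceGL_pow_le_pow hϖ (by omega) hu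
    exact ⟨congruenceGL_pow_le_pow hϖ (by omega) hu, conj_mem_congruenceGL_of_adBall hϖ hy hu'⟩
  have hUc : ∀ r, IsClosed ((U r : Subgroup (GL (Fin 2) F)) : Set (GL (Fin 2) F)) := fun _ => isClosed_unipotentRadicalGL (id : Fin 2 → Fin 2)
  have hCΩ : {x : GL (Fin 2) F | ∀ i j k l, Valued.v (ϖ ^ mC * ((x : Matrix (Fin 2) (Fin 2) F) i j *
      ((x⁻¹ : GL (Fin 2) F) : Matrix (Fin 2) (Fin 2) F) k l)) ≤ 1} ⊆ Ω mC := fun g hg => hg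
  -- the honest cusp condition
  have hcusp : ∀ σ (r : Fin 1), ∀ ν₀ : Measure ↥(U r), ν₀.IsHaarMeasure → ∀ x : GL (Fin 2) F, ∫ u : ↥(U r), f (x * (w σ * ↑u * (w σ)⁻¹)) ∂ν₀ = 0 :=
    fun σ _ => hcuspB σ
  -- the cover: chamber × (the one) regime
  have hcover : ∀ a ∈ A, a ∉ Ω E → ∃ (σ : Equiv.Perm (Fin 2)) (r : Fin 1), (w σ)⁻¹ * a * w σ ∈ P r := by
    intro a ha haR
    have hd := coe_eq_diagonal_of_mem_standardLeviGL_id ha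
    obtain ⟨σ, h1, h2⟩ := cover_of_not_adBall_two hϖ hd (le_refl E) haR
    have hconj := coe_permGL_inv_mul_mul_permGL σ⁻¹ hd
    rw [inv_inv] at hconj
    exact ⟨σ⁻¹, 0, _, hconj, h1, h2⟩
  -- the six structural hypotheses for the Borel direction (★ (B-Iw), ★ (B-val))
  have hIw : ∀ r, ∀ k ∈ K₀, ∃ v ∈ K₀ ⊓ V r, ∃ t ∈ K₀ ⊓ T r, ∃ u ∈ K₀ ⊓ U r, k = v * t * u := fun _ k hk =>
    K2E3GLnCongruenceIwahoriOrders.forall_exists_mul_of_coe_eq_mul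
      (K2E3GLnCongruenceIwahoriOrders.coe_congruenceGL_eq_mul_iwahori (id : Fin 2 → Fin 2) hγ1) k hk
  have h54 : ∀ r, ∀ u ∈ U r, ∀ a' ∈ A, ∀ k : ℕ, u * a' ∈ Ω k → u ∈ Ω (2 * k) := fun _ u hu a' ha' k huk =>
    adBall_two_mul_of_mem_unipotentRadicalGL (id : Fin 2 → Fin 2) ϖ (coe_eq_diagonal_of_mem_standardLeviGL_id ha') hu huk
  have hϖh1 : ∀ h : ℕ, Valued.v (ϖ ^ h) ≤ 1 := fun h => by
    rw [CartanUnique.v_uniformizer_pow hϖ h, ← WithZero.exp_zero, WithZero.exp_le_exp]; omega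
  have hV' : ∀ r, ∀ a ∈ P r, ∀ v ∈ K₀ ⊓ V r, a * v * a⁻¹ ∈ K₀ := by
    intro _ a ha v hv
    obtain ⟨d, hd, h1, -⟩ := ha
    exact conj_mem_congruenceGL_of_mem_oppositeRadical (id : Fin 2 → Fin 2) hd (fun i j hij => (h1 i j hij).trans (hϖh1 _))
      (Subgroup.mem_inf.1 hv).1 (Subgroup.mem_inf.1 hv).2
  have hT' : ∀ r, ∀ a ∈ P r, ∀ t ∈ K₀ ⊓ T r, a * t * a⁻¹ ∈ Ω (D r) := by
    intro _ a ha t ht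
    obtain ⟨d, hd, -, h2⟩ := ha
    exact adBall_conj_of_mem_standardLeviGL (id : Fin 2 → Fin 2) ϖ hd h2 (Subgroup.mem_inf.1 ht).1 (Subgroup.mem_inf.1 ht).2
  have hnormU : ∀ r, ∀ a ∈ P r, ∀ u ∈ U r, a * u * a⁻¹ ∈ U r := by
    intro _ a ha u hu
    obtain ⟨d, hd, -, -⟩ := ha
    exact conj_mem_unipotentRadicalGL_of_coe_eq_diagonal (id : Fin 2 → Fin 2) hd hu
  have hcontr : ∀ r, ∀ a ∈ P r, ∀ (k j : ℕ), j + k ≤ m + 2 * s + (4 * mC + 2 * D r) + 1 → ∀ u ∈ U r, u ∈ Ω k → a⁻¹ * u * a ∈ L j := by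
    intro _ a ha k j hjk u hu huk
    obtain ⟨d, hd, h1, -⟩ := ha
    exact inv_conj_mem_congruenceGL_of_adBall (id : Fin 2 → Fin 2) hϖ hd h1 hu huk (by simp [hD] at hjk; omega)
  -- assemble: ★ (A′) on the level `K₁ = GL₂(𝒪)`
  have hx' : x ∉ Ω (mC + E + s) := hx
  exact cuspForm_cancellation_polychotomy_levelOne_of_base μ Ω hΩmul hΩinv (glInt 2 F) K₀ A T U V P D L w
    (fun σ k hk => hwK σ m k hk) (fun σ k hk => hwK' σ m k hk) hwΩ hwΩ' (fun σ j g hg => hwK σ j g hg) hwA'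
    hK₁Ω hK₀K₁ hK₁o hK₁c hK₀o hK₀c hy hdeep hUc f hf _ hCΩ hsupp hcusp hcover hIw h54 hV' hT' hnormU hcontr hx'

end Split

end Summit.HodgeConjecture.HodgeConjecture.Cruxes.H413.K2E3GL2CuspFormCancellation

end
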